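import Literature.Probability.LatticeModels.LatticeGreenRiemannSum
import Literature.Probability.LatticeModels.TorusFourierProofs
import HarnessLib

/-!
# Block sums of the lattice Green function: `∑_{x,y ∈ Λ_n} G(x - y) ≤ C n^{d+2}` for `d ≥ 3`

Trunk G02 (T-STATMECH), topic `Probability/LatticeModels`, namespace `Literature.StatMech`.
Theorem-only file (no definitions, no named facts); pure finite Fourier analysis on the torus
`(ℤ/Lℤ)^d` plus the limit `G_L → G` of `LatticeGreenRiemannSum.lean`.

This is the quantitative form of the Cesàro decay `|Λ_N|⁻² ∑_{x,y ∈ Λ_N} G(x - y) → 0`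
(`tendsto_latticeGreen_blockAverage`, ADS15 (3.16)) that the `x`-space infrared bound needs:
with the Gaussian domination bound of Aizenman–Duminil-Copin–Sidoravicius, CMP 334 (2015), §3.3,
(3.13)/(3.19) (`LroInfraredBound.lean`: `∑_{x,y ∈ Λ_n} ⟨σ_xσ_y⟩^f_{β_c} ≤ (2β_c)⁻¹ ∑_{x,y ∈ Λ_n} G(x-y)`)
and the Messager–Miracle-Solé monotonicity it yields the pointwise bound
`⟨σ_0σ_x⟩_{β_c} ≤ C ‖x‖^{2-d}` (Duminil-Copin, *Lectures on the Ising and Potts models on the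
hypercubic lattice* (2019), §4.3, remark after (IR): "the infrared bound is proved in Fourier
space, and involves an averaging over `y`. One may then use the Messager-Miracle inequality … to
get a bound for any fixed `x` and `y`"; Sokal, Ann. Inst. H. Poincaré A 37 (1982) 317, App. A).
The present file supplies the averaged Green-function side of that remark.

## Contents (all `Literature.StatMech`, `d ≥ 3`, tree normalisation `G = latticeGreen`, `G_L = torusGreen`)

* `torusGreen_blockSum_le` — for even `L`, every `B ⊆ (ℤ/Lℤ)^d` and every `η > 0`,
  `∑_{x,y ∈ B} G_L(x - y) ≤ (π² d 3^{d-1}/(2π)^d) |B|² η^{d-2} + (π²/2) |B| η⁻²`.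
  Proof: `∑_{x,y ∈ B} G_L(x-y) = L^{-d} ∑_{k ≠ 0} |1̂_B(k)|² / ε(p_k)` (characters,
  `sum_sum_mul_torusFourierInv_re`); the momenta with `ε(p_k) < 2η²/π²` lie within `η` of `0`
  (`ε(p) ≥ (2/π²)‖p‖²_∞`) and contribute at most `|B|² L^{-d} ∑_{0<‖p_k‖≤η} ε(p_k)⁻¹ ≤
  |B|² (2π)^{-d} π² d 3^{d-1} η^{d-2}` (`|1̂_B| ≤ |B|` and the grid-sum bound
  `sum_nearCells_abs_greenIntegrand_le` of `LatticeGreenRiemannSum.lean`); the others have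
  `ε(p_k)⁻¹ ≤ π²/(2η²)` and contribute at most `π²/(2η²) L^{-d} ∑_k |1̂_B(k)|² = π²/(2η²) |B|`
  (Parseval, `torusFourier_plancherel`).
* `latticeGreen_blockSum_le` — the same bound for `∑_{x,y ∈ Λ_n} G(x - y)` on `ℤ^d`
  (`|B| = (2n+1)^d`), by `G_L → G` (`torusGreen_tendsto_latticeGreen`) along even `L > 2n`.
* `exists_latticeGreen_blockSum_le` — with `η = 1/n`:
  `∑_{x,y ∈ Λ_n} G(x - y) ≤ C_d n^{d+2}` for all `n ≥ 1`,
  `C_d = 9^d π² d 3^{d-1}/(2π)^d + 3^d π²/2`.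

## Mathlib status

Finite Fourier analysis on `(ℤ/Lℤ)^d` is the tree's (`TorusFourierProofs.lean`, built on Mathlib's
`ZMod.stdAddChar`); Mathlib has no lattice Green function. Anchors: `Finset.sum_image`,
`Int.eq_zero_of_abs_lt_dvd`, `ZMod.intCast_eq_intCast_iff_dvd_sub`, `Equiv.sum_comp`
(`Torus.proj (x - y) = Torus.proj x - Torus.proj y` is the tree's `Literature.Probability.LatticeModels.torusProj_sub` of
`LroInfraredBound.lean`, which this analysis file must not import; it is re-derived inline).
-/

noncomputable section

open MeasureTheory Filter Topology Finset Real

namespace Literature.Probability.LatticeModels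

variable {d : ℕ}

/-! ### Elementary lemmas -/

/-- `ε` is `2π`-periodic in every coordinate. [folklore] -/
theorem dispersion_add_int_mul (p : Fin d → ℝ) (q : Fin d → ℤ) :
    dispersion (fun i => p i + 2 * π * q i) = dispersion p := by
  unfold dispersion
  refine Finset.sum_congr rfl fun i _ => ?_
  show 1 - Real.cos (p i + 2 * π * q i) = 1 - Real.cos (p i)
  rw [show p i + 2 * π * q i = p i + q i * (2 * π) by ring, Real.cos_add_int_mul_two_pi]

/-- `h_0(p) = ε(p)⁻¹` (with Lean's `0⁻¹ = 0` at `ε(p) = 0`). [folklore] -/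
theorem greenIntegrand_zero_left (p : Fin d → ℝ) : greenIntegrand 0 p = (dispersion p)⁻¹ := by
  simp [greenIntegrand]

/-- `p_0 = 0`. [folklore] -/
theorem latticeMomentum_zero (L : ℕ) : latticeMomentum L (0 : TorusSite d L) = 0 := by
  funext i; simp [latticeMomentum]

/-- `ε(0) = 0`. [folklore] -/
theorem dispersion_zero : dispersion (0 : Fin d → ℝ) = 0 := by
  simp [dispersion]

/-- Summing against the indicator weight of `B` restricts the sum to `B`. [folklore] -/
private theorem sum_indicator_weight_mul {α : Type*} [Fintype α] [DecidableEq α] (B : Finset α)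
    (h : α → ℝ) : ∑ x, (if x ∈ B then (1 : ℝ) else 0) * h x = ∑ x ∈ B, h x := by
  have : ∀ x, (if x ∈ B then (1 : ℝ) else 0) * h x = if x ∈ B then h x else 0 := fun x => by
    split_ifs <;> simp
  simp_rw [this]
  rw [Finset.sum_ite_mem, Finset.univ_inter]

/-! ### Block sums of the torus Green function -/

section Torus

variable {L : ℕ} [NeZero L]

/-- `|𝓕v(k)| ≤ ∑_x |v_x|` for real `v`. [folklore] -/
theorem norm_torusFourier_ofReal_le (v : TorusSite d L → ℝ) (k : TorusSite d L) :
    ‖torusFourier (fun x => (v x : ℂ)) k‖ ≤ ∑ x, |v x| := by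
  rw [torusFourier_eq_sum_torusChar]
  refine (norm_sum_le _ _).trans (le_of_eq (Finset.sum_congr rfl fun x _ => ?_))
  rw [norm_mul, Complex.norm_real, Real.norm_eq_abs, Complex.norm_conj, norm_torusChar, mul_one]

/-- **Block sums of the torus Green function.** For `d ≥ 3`, even `L`, every finite
`B ⊆ (ℤ/Lℤ)^d` and every `η > 0`,
`∑_{x,y ∈ B} G_L(x - y) ≤ (π² d 3^{d-1}/(2π)^d) |B|² η^{d-2} + (π²/2) |B| / η²`
(split of `L^{-d} ∑_{k≠0} |1̂_B(k)|²/ε(p_k)` into the momenta with `ε(p_k) < 2η²/π²`, bounded through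
`|1̂_B| ≤ |B|` and the grid sum `∑_{0 < ‖p_k‖ ≤ η} L^{-d} ε(p_k)⁻¹ ≤ (2π)^{-d} π² d 3^{d-1} η^{d-2}`, and
the rest, bounded through `ε⁻¹ ≤ π²/(2η²)` and Parseval). The averaged (`x`-space) side of the
infrared bound (Sokal, Ann. Inst. H. Poincaré A 37 (1982) 317, App. A; Duminil-Copin 2019, §4.3,
remark after (IR)). [folklore] -/
theorem torusGreen_blockSum_le (hd : 3 ≤ d) (hL : Even L) (B : Finset (TorusSite d L))
    {η : ℝ} (hη : 0 < η) :
    ∑ x ∈ B, ∑ y ∈ B, torusGreen (x - y) ≤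
      π ^ 2 * d * 3 ^ (d - 1) / (2 * π) ^ d * (#B : ℝ) ^ 2 * η ^ (d - 2) +
        π ^ 2 / 2 * (#B : ℝ) / η ^ 2 := by
  classical
  have hLpos : (0 : ℝ) < L := Nat.cast_pos.2 (Nat.pos_of_ne_zero (NeZero.ne L))
  have hLd : (0 : ℝ) < (L : ℝ) ^ d := by positivity
  have hδ := gridStep_pos L
  set N : ℝ := (#B : ℝ) with hN
  set v : TorusSite d L → ℝ := fun x => if x ∈ B then 1 else 0 with hv
  have hv01 : ∀ x, v x = 0 ∨ v x = 1 := fun x => by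
    by_cases hx : x ∈ B <;> simp [hv, hx]
  have hv_nonneg : ∀ x, 0 ≤ v x := fun x => by rcases hv01 x with h | h <;> simp [h]
  have hv_sum : ∑ x, v x = N := by
    have h := sum_indicator_weight_mul B fun _ => (1 : ℝ)
    simp only [mul_one, sum_const] at h
    rw [hN, show ∑ x, v x = ∑ x, (if x ∈ B then (1 : ℝ) else 0) from rfl, h, nsmul_eq_mul,
      mul_one]
  -- the symbol `1_{k ≠ 0} / ε(p_k)` and the Fourier weights `w_k = |𝓕v(k)|²`
  set gε : TorusSite d L → ℂ := fun k =>
    if k = 0 then (0 : ℂ) else ((dispersion (latticeMomentum L k))⁻¹ : ℝ) with hgε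
  set g : TorusSite d L → ℝ := fun k => (dispersion (latticeMomentum L k))⁻¹ with hg
  set w : TorusSite d L → ℝ := fun k => ‖torusFourier (fun x => (v x : ℂ)) k‖ ^ 2 with hw
  have hgre : ∀ k, (gε k).re = g k := fun k => by
    by_cases hk : k = 0
    · simp [hgε, hg, hk, latticeMomentum_zero, dispersion_zero]
    · simp [hgε, hg, hk]
  have hg_nonneg : ∀ k, 0 ≤ g k := fun k => inv_nonneg.2 (dispersion_nonneg _)
  have hw_nonneg : ∀ k, 0 ≤ w k := fun k => by positivity
  -- (1) the block sum as a quadratic form, in Fourier variables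
  have hG : ∀ z : TorusSite d L, torusGreen z = (torusFourierInv gε z).re := fun z => by
    rw [torusFourierInv_eq_sum_torusChar, torusGreen]
    have hc : (((L : ℂ) ^ d)⁻¹) = ((((L : ℝ) ^ d)⁻¹ : ℝ) : ℂ) := by push_cast; rfl
    rw [hc, Complex.re_ofReal_mul, Complex.re_sum, div_eq_inv_mul]
    congr 1
    rw [← Finset.sum_erase_add _ _ (Finset.mem_univ (0 : TorusSite d L))]
    simp only [hgε, if_true, zero_mul, Complex.zero_re, add_zero]
    refine Finset.sum_congr rfl fun k hk => ?_
    rw [if_neg (Finset.ne_of_mem_erase hk), Complex.re_ofReal_mul, torusChar_re, div_eq_inv_mul]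
  have hquad : ∑ x ∈ B, ∑ y ∈ B, torusGreen (x - y) =
      ((L : ℝ) ^ d)⁻¹ * ∑ k, g k * w k := by
    have h1 : ∑ x ∈ B, ∑ y ∈ B, torusGreen (x - y) = ∑ x, ∑ y, v x * v y * torusGreen (x - y) := by
      rw [← sum_indicator_weight_mul B]
      refine Finset.sum_congr rfl fun x _ => ?_
      rw [← sum_indicator_weight_mul B, Finset.mul_sum]
      refine Finset.sum_congr rfl fun y _ => ?_
      simp only [hv]
      ring
    rw [h1]
    simp_rw [hG]
    rw [sum_sum_mul_torusFourierInv_re]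
    simp_rw [hgre]
    rfl
  -- (2) `w_k ≤ N²` and Parseval `∑_k w_k = L^d N`
  have hw_le : ∀ k, w k ≤ N ^ 2 := fun k => by
    have h1 : ‖torusFourier (fun x => (v x : ℂ)) k‖ ≤ N := by
      refine (norm_torusFourier_ofReal_le v k).trans (le_of_eq ?_)
      rw [← hv_sum]
      exact Finset.sum_congr rfl fun x _ => abs_of_nonneg (hv_nonneg x)
    have h0 : 0 ≤ ‖torusFourier (fun x => (v x : ℂ)) k‖ := norm_nonneg _
    simp only [hw]
    nlinarith
  have hw_sum : ∑ k, w k = (L : ℝ) ^ d * N := by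
    have hP := torusFourier_plancherel_holds (d := d) (L := L) (fun x => (v x : ℂ))
    simp only [hw]
    rw [hP]
    congr 1
    rw [← hv_sum]
    refine Finset.sum_congr rfl fun x _ => ?_
    rw [Complex.norm_real, Real.norm_eq_abs, sq_abs]
    rcases hv01 x with h | h <;> simp [h]
  -- (3) the near momenta: `ε(p_k) < τ := 2η²/π²` forces `‖c‖ < η` for the centred representative
  set τ : ℝ := 2 * η ^ 2 / π ^ 2 with hτ
  have hτpos : 0 < τ := by positivity
  set F : (Fin d → ℝ) → ℝ := fun p => if dispersion p < τ then (dispersion p)⁻¹ else 0 with hF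
  have hF_per : ∀ (p : Fin d → ℝ) (q : Fin d → ℤ), F (fun i => p i + 2 * π * q i) = F p :=
    fun p q => by simp only [hF, dispersion_add_int_mul]
  have hnear_reindex : ∑ k : TorusSite d L, F (latticeMomentum L k) =
      ∑ j : TorusSite d L, F (cellCorner j) := by
    have hterm : ∀ k : TorusSite d L, F (latticeMomentum L k) =
        F (cellCorner (k + centerIndex d L)) := fun k => by
      obtain ⟨q, hq⟩ := cellCorner_add_centerIndex hL k
      rw [hq, hF_per]
    simp_rw [hterm]
    exact Equiv.sum_comp (Equiv.addRight (centerIndex d L)) fun j : TorusSite d L => F (cellCorner j)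
  set S := (nearCells d L η).erase (centerIndex d L) with hS
  have hF_le : ∀ j : TorusSite d L, F (cellCorner j) ≤
      if j ∈ S then |greenIntegrand 0 (cellCorner j)| else 0 := fun j => by
    have hRHS : 0 ≤ (if j ∈ S then |greenIntegrand 0 (cellCorner j)| else 0 : ℝ) := by
      split_ifs <;> simp
    by_cases hlt : dispersion (cellCorner j) < τ
    · have hFj : F (cellCorner j) = (dispersion (cellCorner j))⁻¹ := by simp only [hF, if_pos hlt]
      rw [hFj]
      by_cases h0 : dispersion (cellCorner j) = 0
      · rw [h0, inv_zero]; exact hRHS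
      · have hpos : 0 < dispersion (cellCorner j) :=
          lt_of_le_of_ne (dispersion_nonneg _) (Ne.symm h0)
        have hnorm : ‖cellCorner j‖ < η := by
          have h1 := mul_norm_sq_le_dispersion (cellCorner_mem_brillouin j)
          have h4 : ‖cellCorner j‖ ^ 2 < η ^ 2 := by
            by_contra hcon
            push Not at hcon
            have : 2 * η ^ 2 / π ^ 2 ≤ 2 / π ^ 2 * ‖cellCorner j‖ ^ 2 := by
              rw [div_mul_eq_mul_div]; gcongr
            linarith
          have h5 := abs_lt_of_sq_lt_sq h4 hη.le
          rwa [abs_of_nonneg (norm_nonneg _)] at h5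
        have hjS : j ∈ S := by
          refine Finset.mem_erase.2 ⟨fun hj => h0 ?_, ?_⟩
          · rw [hj, cellCorner_centerIndex d hL, dispersion_zero]
          · unfold nearCells
            refine Finset.mem_filter.2 ⟨Finset.mem_univ _, fun i => ?_⟩
            rw [← Real.norm_eq_abs]
            exact (norm_le_pi_norm _ i).trans hnorm.le
        rw [if_pos hjS, greenIntegrand_zero_left, abs_of_pos (inv_pos.2 hpos)]
    · have hFj : F (cellCorner j) = 0 := by simp only [hF, if_neg hlt]
      rw [hFj]
      exact hRHS
  have hnear : ∑ k : TorusSite d L, F (latticeMomentum L k) ≤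
      (gridStep L ^ d)⁻¹ * (π ^ 2 * d * 3 ^ (d - 1) * η ^ (d - 2)) := by
    have hgrid := sum_nearCells_abs_greenIntegrand_le d hd hL (0 : Site d) hη
    have hδd : 0 < gridStep L ^ d := by positivity
    rw [hnear_reindex]
    calc ∑ j : TorusSite d L, F (cellCorner j)
        ≤ ∑ j : TorusSite d L, (if j ∈ S then |greenIntegrand 0 (cellCorner j)| else 0) :=
          Finset.sum_le_sum fun j _ => hF_le j
      _ = ∑ j ∈ S, |greenIntegrand 0 (cellCorner j)| := by
          rw [Finset.sum_ite_mem, Finset.univ_inter]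
      _ = (gridStep L ^ d)⁻¹ * ∑ j ∈ S, gridStep L ^ d * |greenIntegrand 0 (cellCorner j)| := by
          rw [← Finset.mul_sum, ← mul_assoc, inv_mul_cancel₀ hδd.ne', one_mul]
      _ ≤ (gridStep L ^ d)⁻¹ * (π ^ 2 * d * 3 ^ (d - 1) * η ^ (d - 2)) := by
          gcongr
  -- (4) termwise split into near and far momenta
  have hsplit : ∀ k, g k * w k ≤ N ^ 2 * F (latticeMomentum L k) + τ⁻¹ * w k := fun k => by
    simp only [hF]
    split_ifs with hlt
    · have h1 : g k * w k ≤ g k * N ^ 2 := mul_le_mul_of_nonneg_left (hw_le k) (hg_nonneg k)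
      have h2 : 0 ≤ τ⁻¹ * w k := mul_nonneg (inv_nonneg.2 hτpos.le) (hw_nonneg k)
      simp only [hg] at h1 ⊢
      nlinarith
    · push Not at hlt
      have h1 : g k ≤ τ⁻¹ := by
        simp only [hg]
        by_cases h0 : dispersion (latticeMomentum L k) = 0
        · rw [h0, inv_zero]; exact inv_nonneg.2 hτpos.le
        · exact (inv_le_inv₀ (lt_of_le_of_ne (dispersion_nonneg _) (Ne.symm h0)) hτpos).2 hlt
      have h2 := mul_le_mul_of_nonneg_right h1 (hw_nonneg k)
      nlinarith [sq_nonneg N]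
  have hsum : ∑ k, g k * w k ≤
      N ^ 2 * ((gridStep L ^ d)⁻¹ * (π ^ 2 * d * 3 ^ (d - 1) * η ^ (d - 2))) +
        τ⁻¹ * ((L : ℝ) ^ d * N) := by
    calc ∑ k, g k * w k ≤ ∑ k, (N ^ 2 * F (latticeMomentum L k) + τ⁻¹ * w k) :=
          Finset.sum_le_sum fun k _ => hsplit k
      _ = N ^ 2 * ∑ k, F (latticeMomentum L k) + τ⁻¹ * ∑ k, w k := by
          rw [Finset.sum_add_distrib, Finset.mul_sum, Finset.mul_sum]
      _ ≤ N ^ 2 * ((gridStep L ^ d)⁻¹ * (π ^ 2 * d * 3 ^ (d - 1) * η ^ (d - 2))) +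
            τ⁻¹ * ((L : ℝ) ^ d * N) := by
          rw [hw_sum]
          gcongr
  -- (5) assemble: `L^{-d} δ^{-d} = (2π)^{-d}` and `τ⁻¹ = π²/(2η²)`
  rw [hquad]
  have hLδ : ((L : ℝ) ^ d)⁻¹ * (gridStep L ^ d)⁻¹ = ((2 * π) ^ d)⁻¹ := by
    rw [← mul_inv, ← mul_pow, mul_comm (L : ℝ), gridStep_mul]
  have hτinv : τ⁻¹ = π ^ 2 / 2 / η ^ 2 := by
    rw [hτ]
    have hπ : (π : ℝ) ≠ 0 := Real.pi_ne_zero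
    have hη' : η ≠ 0 := hη.ne'
    field_simp
  calc ((L : ℝ) ^ d)⁻¹ * ∑ k, g k * w k
      ≤ ((L : ℝ) ^ d)⁻¹ * (N ^ 2 * ((gridStep L ^ d)⁻¹ * (π ^ 2 * d * 3 ^ (d - 1) * η ^ (d - 2))) +
          τ⁻¹ * ((L : ℝ) ^ d * N)) :=
        mul_le_mul_of_nonneg_left hsum (inv_nonneg.2 hLd.le)
    _ = ((L : ℝ) ^ d)⁻¹ * (gridStep L ^ d)⁻¹ * (π ^ 2 * d * 3 ^ (d - 1)) * N ^ 2 * η ^ (d - 2) +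
          τ⁻¹ * N * (((L : ℝ) ^ d)⁻¹ * (L : ℝ) ^ d) := by ring
    _ = π ^ 2 * d * 3 ^ (d - 1) / (2 * π) ^ d * N ^ 2 * η ^ (d - 2) + π ^ 2 / 2 * N / η ^ 2 := by
        rw [hLδ, inv_mul_cancel₀ hLd.ne', mul_one, hτinv]
        ring

end Torus

/-! ### Block sums of the lattice Green function of `ℤ^d` -/

/-- **Block sums of the lattice Green function.** For `d ≥ 3`, every `n` and every `η > 0`,
`∑_{x,y ∈ Λ_n} G(x - y) ≤ (π² d 3^{d-1}/(2π)^d) (2n+1)^{2d} η^{d-2} + (π²/2) (2n+1)^d / η²`, from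
`torusGreen_blockSum_le` on even tori `(ℤ/Lℤ)^d` with `L > 2n` (so that `Λ_n` embeds) and the
limit `G_L → G` (`torusGreen_tendsto_latticeGreen`). [folklore] -/
theorem latticeGreen_blockSum_le (hd : 3 ≤ d) (n : ℕ) {η : ℝ} (hη : 0 < η) :
    ∑ x ∈ box d n, ∑ y ∈ box d n, latticeGreen (x - y) ≤
      π ^ 2 * d * 3 ^ (d - 1) / (2 * π) ^ d * ((2 * n + 1 : ℝ) ^ d) ^ 2 * η ^ (d - 2) +
        π ^ 2 / 2 * (2 * n + 1 : ℝ) ^ d / η ^ 2 := by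
  classical
  set B := box d n with hB
  have hcard : (#B : ℝ) = (2 * n + 1 : ℝ) ^ d := by rw [hB, card_box]; push_cast; ring
  have hNpos : (0 : ℝ) < (2 * n + 1 : ℝ) ^ d := by positivity
  refine le_of_forall_pos_le_add fun δ' hδ' => ?_
  set ε₁ : ℝ := δ' / ((2 * n + 1 : ℝ) ^ d) ^ 2 with hε₁
  have hε₁pos : 0 < ε₁ := by positivity
  -- `G_L → G` on the finitely many differences
  have hGL : ∀ᶠ L : ℕ in atTop, ∀ p ∈ B ×ˢ B, ∀ [NeZero L], Even L →
      |torusGreen (Torus.proj L (p.1 - p.2)) - latticeGreen (p.1 - p.2)| ≤ ε₁ := by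
    refine (eventually_all_finset (B ×ˢ B)).2 fun p _ => ?_
    obtain ⟨L₀, hL₀⟩ := torusGreen_tendsto_latticeGreen d hd (p.1 - p.2) hε₁pos
    exact eventually_atTop.2 ⟨L₀, fun L hL _ hLe => hL₀ L hLe hL⟩
  obtain ⟨L₁, hL₁⟩ := eventually_atTop.1 hGL
  set L := 2 * (L₁ + n + 1) with hL
  haveI : NeZero L := ⟨by omega⟩
  have hLe : Even L := ⟨L₁ + n + 1, by omega⟩
  have hGL_L := hL₁ L (by omega)
  -- `Λ_n` embeds in the torus
  have hinj : ∀ x ∈ B, ∀ y ∈ B, Torus.proj L x = Torus.proj L y → x = y := by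
    intro x hx y hy hxy
    funext i
    have hi : (x i : ZMod L) = (y i : ZMod L) := by
      simpa [Torus.proj] using congr_fun hxy i
    rw [ZMod.intCast_eq_intCast_iff_dvd_sub] at hi
    have hxi := (mem_box.1 hx) i
    have hyi := (mem_box.1 hy) i
    have habs : |y i - x i| < (L : ℤ) := by
      rw [abs_lt]; constructor <;> push_cast [hL] <;> omega
    have h0 := Int.eq_zero_of_abs_lt_dvd hi habs
    omega
  have himg : #(B.image (Torus.proj L)) = #B := Finset.card_image_of_injOn hinj
  -- compare with the torus block sum
  have h1 : ∑ x ∈ B, ∑ y ∈ B, latticeGreen (x - y) ≤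
      ∑ x ∈ B, ∑ y ∈ B, (torusGreen (Torus.proj L x - Torus.proj L y) + ε₁) :=
    Finset.sum_le_sum fun x hx => Finset.sum_le_sum fun y hy => by
      have h := hGL_L (x, y) (Finset.mk_mem_product hx hy) hLe
      have hsub : Torus.proj L (x - y) = Torus.proj L x - Torus.proj L y := by
        funext i; simp [Torus.proj]
      rw [hsub] at h
      linarith [(abs_sub_le_iff.1 h).2]
  have h2 : ∑ x ∈ B, ∑ y ∈ B, (torusGreen (Torus.proj L x - Torus.proj L y) + ε₁) =
      ∑ x' ∈ B.image (Torus.proj L), ∑ y' ∈ B.image (Torus.proj L), torusGreen (x' - y') +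
        (#B : ℝ) ^ 2 * ε₁ := by
    rw [Finset.sum_image hinj]
    simp only [Finset.sum_add_distrib, Finset.sum_const, nsmul_eq_mul]
    rw [Finset.sum_congr rfl fun x _ => Finset.sum_image hinj]
    ring
  have h3 := torusGreen_blockSum_le hd hLe (B.image (Torus.proj L)) hη
  rw [himg, hcard] at h3
  have h4 : (#B : ℝ) ^ 2 * ε₁ = δ' := by
    rw [hcard, hε₁]
    field_simp
  linarith [h1, h2.le, h2.ge, h3, h4]

variable (d) in
/-- **`∑_{x,y ∈ Λ_n} G(x - y) ≤ C_d n^{d+2}`** for `d ≥ 3` and `n ≥ 1`, with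
`C_d = 9^d π² d 3^{d-1}/(2π)^d + 3^d π²/2` (`latticeGreen_blockSum_le` with `η = 1/n`): the block
double sums of the lattice Green function grow like `|Λ_n| · n²`, the quantitative form of the
Cesàro decay `tendsto_latticeGreen_blockAverage` (ADS15 (3.16)) used for the `x`-space infrared
bound (Duminil-Copin 2019, §4.3, remark after (IR); Sokal 1982, App. A). [folklore] -/
theorem exists_latticeGreen_blockSum_le (hd : 3 ≤ d) :
    ∃ C : ℝ, 0 ≤ C ∧ ∀ n : ℕ, 1 ≤ n →
      ∑ x ∈ box d n, ∑ y ∈ box d n, latticeGreen (x - y) ≤ C * (n : ℝ) ^ (d + 2) := by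
  set A : ℝ := π ^ 2 * d * 3 ^ (d - 1) / (2 * π) ^ d with hA
  have hA0 : 0 ≤ A := by positivity
  refine ⟨A * 9 ^ d + π ^ 2 / 2 * 3 ^ d, by positivity, fun n hn => ?_⟩
  have hn0 : (0 : ℝ) < n := by exact_mod_cast hn
  have h := latticeGreen_blockSum_le hd n (η := 1 / n) (by positivity)
  obtain ⟨e, rfl⟩ : ∃ e, d = e + 2 := ⟨d - 2, by omega⟩
  rw [show e + 2 - 2 = e by omega] at h
  have h3n : (2 * n + 1 : ℝ) ≤ 3 * n := by
    have : (1 : ℝ) ≤ n := by exact_mod_cast hn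
    linarith
  have hpow : (2 * n + 1 : ℝ) ^ (e + 2) ≤ 3 ^ (e + 2) * (n : ℝ) ^ (e + 2) := by
    rw [← mul_pow]; gcongr
  -- first term: `A (2n+1)^{2d} n^{-(d-2)} ≤ A 9^d n^{d+2}`
  have hT1 : A * ((2 * n + 1 : ℝ) ^ (e + 2)) ^ 2 * (1 / n) ^ e ≤ A * 9 ^ (e + 2) * (n : ℝ) ^ (e + 2 + 2) := by
    have h1 : ((2 * n + 1 : ℝ) ^ (e + 2)) ^ 2 ≤ (3 ^ (e + 2) * (n : ℝ) ^ (e + 2)) ^ 2 := by gcongr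
    have h2 : (3 ^ (e + 2) * (n : ℝ) ^ (e + 2)) ^ 2 * (1 / n) ^ e = 9 ^ (e + 2) * (n : ℝ) ^ (e + 2 + 2) := by
      have hn' : (n : ℝ) ≠ 0 := hn0.ne'
      have k1 : ((3 : ℝ) ^ (e + 2)) ^ 2 = 9 ^ (e + 2) := by
        rw [← pow_mul, mul_comm, pow_mul]; norm_num
      have k2 : ((n : ℝ) ^ (e + 2)) ^ 2 * (1 / n) ^ e = (n : ℝ) ^ (e + 2 + 2) := by
        rw [one_div, inv_pow, ← pow_mul]
        field_simp
        ring
      calc (3 ^ (e + 2) * (n : ℝ) ^ (e + 2)) ^ 2 * (1 / n) ^ e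
          = ((3 : ℝ) ^ (e + 2)) ^ 2 * (((n : ℝ) ^ (e + 2)) ^ 2 * (1 / n) ^ e) := by ring
        _ = 9 ^ (e + 2) * (n : ℝ) ^ (e + 2 + 2) := by rw [k1, k2]
    calc A * ((2 * n + 1 : ℝ) ^ (e + 2)) ^ 2 * (1 / n) ^ e
        ≤ A * (3 ^ (e + 2) * (n : ℝ) ^ (e + 2)) ^ 2 * (1 / n) ^ e := by gcongr
      _ = A * 9 ^ (e + 2) * (n : ℝ) ^ (e + 2 + 2) := by rw [mul_assoc, h2, ← mul_assoc]
  -- second term: `(π²/2) (2n+1)^d n² ≤ (π²/2) 3^d n^{d+2}`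
  have hT2 : π ^ 2 / 2 * (2 * n + 1 : ℝ) ^ (e + 2) / (1 / n) ^ 2 ≤ π ^ 2 / 2 * 3 ^ (e + 2) * (n : ℝ) ^ (e + 2 + 2) := by
    have h2 : π ^ 2 / 2 * (2 * n + 1 : ℝ) ^ (e + 2) / (1 / n) ^ 2 = π ^ 2 / 2 * ((2 * n + 1 : ℝ) ^ (e + 2) * (n : ℝ) ^ 2) := by
      have hn' : (n : ℝ) ≠ 0 := hn0.ne'
      field_simp
    rw [h2, pow_add _ (e + 2) 2, mul_assoc, ← mul_assoc ((3 : ℝ) ^ (e + 2))]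
    gcongr
  calc ∑ x ∈ box (e + 2) n, ∑ y ∈ box (e + 2) n, latticeGreen (x - y)
      ≤ A * ((2 * n + 1 : ℝ) ^ (e + 2)) ^ 2 * (1 / n) ^ e + π ^ 2 / 2 * (2 * n + 1 : ℝ) ^ (e + 2) / (1 / n) ^ 2 := by
        simpa [hA] using h
    _ ≤ A * 9 ^ (e + 2) * (n : ℝ) ^ (e + 2 + 2) + π ^ 2 / 2 * 3 ^ (e + 2) * (n : ℝ) ^ (e + 2 + 2) := add_le_add hT1 hT2
    _ = (A * 9 ^ (e + 2) + π ^ 2 / 2 * 3 ^ (e + 2)) * (n : ℝ) ^ (e + 2 + 2) := by ring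

end Literature.Probability.LatticeModels
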